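import Summits.Parity.GeneralizedHardyLittlewood.Theorems.FordMaynardSieveConst01651SieveConst01651SignClauseFour
import HarnessLib

/-!
# Route `FordMaynardSieveConst01651`, target `SieveConst01651` (stmt-Parity-19185), stub `stub_coneCertClosed`,
# conjunct (iv) in dimension 5: reduction to the ten complementary couples

Def-free helper file.  Dimension `5` is the one residual dimension of the sign clause (`h5` of
`…SignClauseFour.stub_coneCertClosed_of_residues'`).  This file reduces it, for any cone data `g₀` with `g₀(∅) = 1`, the
closed support clause at `ν ≥ 1/8` and `g₁ ≤ −1` on `(ν, 1/2]`, to a statement about the TEN COUPLES `{A, Aᶜ}`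
(`|A| = 2`, `|Aᶜ| = 3`, `|x_A| + |x_{Aᶜ}| = 1`):

  `(𝟙⋆g₀)(x) ≤ −4 + ∑_{|A| = 2} ( g₀,₂(x_A) + g₀,₃(x_{Aᶜ}) )`      (`starSum_five_le_couples`)

(all five coordinates are `< 1 − 4ν ≤ 1/2`, so the singletons give `≤ −5`; subvectors of dimension `≥ 4` vanish; the
`2`-subsets and `3`-subsets are exchanged by complementation).  In each couple at most one of the two terms is non-zero
off the band line `|x_A| = 1/2` (support), which is the shape a dimension-`5` type checker evaluates through the API of
`…CertReduction` (`coneCert_two_eq_lookup`, `coneCert_three_eq_lookup`, `…_eq_zero_of_half_lt`).  Specialisation: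
`coneCert_five_le_couples`.

References: [FordMaynard2024PrimeSieves] arXiv:2407.14368, Theorem 7.3 (a), §8.2.
-/

noncomputable section

open Finset
open scoped Classical
open Literature.NumberTheory.Sieve Literature.NumberTheory.Sieve.FordMaynard

namespace Summit.Parity.GeneralizedHardyLittlewood.FordMaynardSieveConst01651SieveConst01651

/-- Each coordinate of a box vector on the slice `|x| = 1` in dimension `5` is `< 1 − 4ν`. [folklore] -/
theorem apply_lt_of_five {ν : ℝ} {x : Fin 5 → ℝ} (hbox : ∀ i, ν < x i) (hsum : ∑ i, x i = 1) (i : Fin 5) :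
    x i < 1 - 4 * ν := by
  have h := Finset.add_sum_erase (Finset.univ : Finset (Fin 5)) x (Finset.mem_univ i)
  have hcard : (Finset.univ.erase i).card = 4 := by
    rw [Finset.card_erase_of_mem (Finset.mem_univ i), Finset.card_univ, Fintype.card_fin]
  have hlt : ∑ _j ∈ Finset.univ.erase i, ν < ∑ j ∈ Finset.univ.erase i, x j :=
    Finset.sum_lt_sum_of_nonempty (by rw [← Finset.card_pos, hcard]; norm_num) (fun j _ => hbox j)
  rw [Finset.sum_const, hcard, nsmul_eq_mul] at hlt
  push_cast at hlt
  linarith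

/-- **Dimension 5 reduces to the ten couples.** For cone data with `g₀(∅) = 1`, the closed support clause at `ν ≥ 1/8`
and `g₁ ≤ −1` on `(ν, 1/2]`, every monotone `x ∈ ℝ⁵` with `xᵢ > ν`, `|x| = 1` satisfies
`(𝟙⋆g₀)(x) ≤ −4 + ∑_{|A|=2} (g₀,₂(x_A) + g₀,₃(x_{Aᶜ}))`. [cite: FordMaynard2024PrimeSieves, Theorem 7.3 (a), §8.2] -/
theorem starSum_five_le_couples {ν : ℝ} {g₀ : VecFn}
    (hsupp : ∀ (r : ℕ) (y : Fin r → ℝ), Monotone y → g₀ r y ≠ 0 → r = 0 ∨ ((∀ i, ν < y i) ∧ ∑ i, y i ≤ 1 / 2))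
    (h0 : ∀ e : Fin 0 → ℝ, g₀ 0 e = 1)
    (hg1 : ∀ y : Fin 1 → ℝ, ν < y 0 → y 0 ≤ 1 / 2 → g₀ 1 y ≤ -1)
    (hν : 1 / 8 ≤ ν)
    {x : Fin 5 → ℝ} (hx : Monotone x) (hbox : ∀ i, ν < x i) (hsum : ∑ i, x i = 1) :
    starSum g₀ 5 x ≤ -4 + ∑ A ∈ (Finset.univ : Finset (Finset (Fin 5))).filter (fun A => A.card = 2),
      (g₀ A.card (fun i => x (A.orderEmbOfFin rfl i)) + g₀ Aᶜ.card (fun i => x (Aᶜ.orderEmbOfFin rfl i))) := by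
  have hlt : ∀ i, x i < 1 - 4 * ν := apply_lt_of_five hbox hsum
  have hhalf : ∀ i, x i ≤ 1 / 2 := fun i => by have := hlt i; linarith
  set term : Finset (Fin 5) → ℝ := fun A => g₀ A.card (fun i => x (A.orderEmbOfFin rfl i)) with hterm_def
  set c : ℕ → ℝ := fun r => if r = 0 then 1 else if r = 1 then -1 else 0 with hc
  have hbound : ∀ A : Finset (Fin 5),
      term A ≤ c A.card + (if A.card = 2 then term A else 0) + (if A.card = 3 then term A else 0) := by
    intro A
    by_cases hA0 : A.card = 0
    · have : term A = 1 := by simp only [hterm_def]; rw [← apply_orderEmb_cast' g₀ x A hA0, h0]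
      rw [this, hA0]; simp [hc]
    by_cases hA1 : A.card = 1
    · have hle := apply_single_le hsupp hg1 hx hbox A hA1
      obtain ⟨a, rfl⟩ := Finset.card_eq_one.1 hA1
      rw [Finset.sum_singleton, if_pos (hhalf a)] at hle
      have : term {a} ≤ -1 := by
        simp only [hterm_def]; rw [← apply_orderEmb_cast' g₀ x {a} hA1]; exact hle
      rw [hA1]; simp [hc]; linarith
    by_cases hA2 : A.card = 2
    · rw [hA2]; simp [hc]
    by_cases hA3 : A.card = 3
    · rw [hA3]; simp [hc]
    · have h4 : 4 ≤ A.card := by omega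
      have hz : term A = 0 := by
        simp only [hterm_def]
        refine apply_subvector_eq_zero_of_card hsupp hx hbox A ?_
        have : (4 : ℝ) ≤ A.card := by exact_mod_cast h4
        nlinarith
      rw [hz, if_neg hA2, if_neg hA3]
      have : c A.card = 0 := by simp only [hc]; rw [if_neg hA0, if_neg hA1]
      rw [this]; norm_num
  have hconst : ∑ A : Finset (Fin 5), c A.card = 1 - 5 := by
    rw [← Finset.powerset_univ, Finset.sum_powerset_apply_card]
    simp [hc, Finset.sum_range_succ, Nat.choose, Finset.card_univ, Fintype.card_fin]
    norm_num
  -- the 3-subsets are the complements of the 2-subsets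
  set S2 : Finset (Finset (Fin 5)) := Finset.univ.filter (fun A => A.card = 2) with hS2
  set S3 : Finset (Finset (Fin 5)) := Finset.univ.filter (fun A => A.card = 3) with hS3
  have h23 : ∀ A ∈ S2, Aᶜ ∈ S3 := by
    intro A hA
    simp only [hS2, hS3, Finset.mem_filter, Finset.mem_univ, true_and] at hA ⊢
    rw [Finset.card_compl, Fintype.card_fin, hA]
  have h32 : ∀ A ∈ S3, Aᶜ ∈ S2 := by
    intro A hA
    simp only [hS2, hS3, Finset.mem_filter, Finset.mem_univ, true_and] at hA ⊢
    rw [Finset.card_compl, Fintype.card_fin, hA]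
  have hswap : ∑ A ∈ S3, term A = ∑ A ∈ S2, term Aᶜ := by
    refine Finset.sum_nbij' (fun A => Aᶜ) (fun A => Aᶜ) h32 h23 (fun A _ => compl_compl A)
      (fun A _ => compl_compl A) (fun A _ => ?_)
    simp only [compl_compl]
  calc starSum g₀ 5 x = ∑ A : Finset (Fin 5), term A := rfl
    _ ≤ ∑ A : Finset (Fin 5), (c A.card + (if A.card = 2 then term A else 0) + (if A.card = 3 then term A else 0)) :=
        Finset.sum_le_sum fun A _ => hbound A
    _ = (∑ A : Finset (Fin 5), c A.card) + ∑ A ∈ S2, term A + ∑ A ∈ S3, term A := by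
        rw [Finset.sum_add_distrib, Finset.sum_add_distrib, Finset.sum_filter, Finset.sum_filter]
    _ = (1 - 5) + ∑ A ∈ S2, (term A + term Aᶜ) := by
        rw [hconst, hswap, Finset.sum_add_distrib]; ring
    _ = -4 + ∑ A ∈ S2, (term A + term Aᶜ) := by norm_num

/-- **Dimension 5 for the witness `coneCert`**: `(𝟙⋆coneCert)(x) ≤ −4 + ∑_{|A|=2} (coneCert₂(x_A) + coneCert₃(x_{Aᶜ}))` for
monotone `x ∈ ℝ⁵`, `xᵢ > ν₀`, `|x| = 1` — the shape of the residual `h5`. [cite: FordMaynard2024PrimeSieves, Theorem 7.3 (a), §8.2] -/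
theorem coneCert_five_le_couples (x : Fin 5 → ℝ) (hx : Monotone x) (hbox : ∀ i, (1651 / 10000 : ℝ) < x i)
    (hsum : ∑ i, x i = 1) :
    starSum coneCert 5 x ≤ -4 + ∑ A ∈ (Finset.univ : Finset (Finset (Fin 5))).filter (fun A => A.card = 2),
      (coneCert A.card (fun i => x (A.orderEmbOfFin rfl i)) +
        coneCert Aᶜ.card (fun i => x (Aᶜ.orderEmbOfFin rfl i))) :=
  starSum_five_le_couples coneCert_support coneCert_empty (fun y h1 h2 => coneCert_one_le y h1 h2) (by norm_num)
    hx hbox hsum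

/-- In a couple `{A, Aᶜ}` (`|A| = 2`) at most one side is live: if `|x_A| < 1/2` the triple term vanishes, if `|x_A| > 1/2`
the pair term vanishes (closed support clause; `|x_A| + |x_{Aᶜ}| = 1`). [cite: FordMaynard2024PrimeSieves, (7.1)] -/
theorem couple_one_sided {ν : ℝ} {g₀ : VecFn}
    (hsupp : ∀ (r : ℕ) (y : Fin r → ℝ), Monotone y → g₀ r y ≠ 0 → r = 0 ∨ ((∀ i, ν < y i) ∧ ∑ i, y i ≤ 1 / 2))
    {x : Fin 5 → ℝ} (hx : Monotone x) (hsum : ∑ i, x i = 1) (A : Finset (Fin 5)) (hA : A.card = 2) :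
    (∑ i ∈ A, x i < 1 / 2 → g₀ Aᶜ.card (fun i => x (Aᶜ.orderEmbOfFin rfl i)) = 0) ∧
      (1 / 2 < ∑ i ∈ A, x i → g₀ A.card (fun i => x (A.orderEmbOfFin rfl i)) = 0) := by
  have hsc : ∑ i ∈ A, x i + ∑ i ∈ Aᶜ, x i = 1 := by rw [Finset.sum_add_sum_compl, hsum]
  have hAc : Aᶜ.card = 3 := by rw [Finset.card_compl, Fintype.card_fin, hA]
  constructor
  · intro h
    rw [← apply_orderEmb_cast' g₀ x Aᶜ hAc]
    exact apply_subvector_eq_zero_of_half_lt hsupp hx Aᶜ hAc (by norm_num) (by linarith)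
  · intro h
    rw [← apply_orderEmb_cast' g₀ x A hA]
    exact apply_subvector_eq_zero_of_half_lt hsupp hx A hA two_ne_zero h

end Summit.Parity.GeneralizedHardyLittlewood.FordMaynardSieveConst01651SieveConst01651

end
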